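import Summits.KontsevichZagierPeriods.KontsevichZagierPeriods.Theorems.HoffmanRelationInKZ.Negative.HoffmanElement

/-!
# Crux `HoffmanRelationInKZ` (stmt-KontsevichZagierPeriods-3930): load-bearing hypotheses and refuted strengthenings

Negative lemmas of the crux disprover (landed copy of §2 and §4 of
`Cruxes/HoffmanRelationInKZ/Disproof.lean`). Every hypothesis of the crux is used by any proof, and
the failures are arithmetic (value `> 0`), not junk:

* `false_without_pinning` — drop the pinning of `Z`;
* `false_at_head_one` (every `s = (1, t)`), `false_without_admissibility` — drop admissibility of `s`
  with the canonical classes (`ρ = 0` off admissible indices): Hoffman's formula stops exactly at the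
  `ζ(1)` corner; `hoffmanElement_zetaRep_zero_cons` — head `0` is harmless (`H = 0`);
  `false_at_interior_zero` (every `s = (a, 0, t)`) — interior positivity is load-bearing;
* `mirror_false_at_two` — the increasing-convention placement `(…, j + 1, s_i − j, …)` is NOT a
  relation family for the tree's decreasing convention (convention certified);
* `not_hoffmanTermwise`, `termwise_false_at_two_one_zero` — the termwise strengthening is false at
  `s = (2,1)` in both positions; `hoffmanElement_two_ne_zero` — Euler's instance is not a syntactic
  identity of the free group.

References: M. E. Hoffman, Pacific J. Math. 152 (1992), Thm 5.1; K. Ihara, M. Kaneko, D. Zagier,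
Compositio Math. 142 (2006), Thm 2 (v) (the correct, regularised, extension beyond admissibility).
-/

noncomputable section

namespace Summit.KontsevichZagierPeriods.HoffmanRelationInKZ.Negative

open MeasureTheory Set
open Literature.NumberTheory.Transcendental
open Literature.NumberTheory.Transcendental.KZ
open Summit.KontsevichZagierPeriods.KontsevichZagierPeriods.Theses.FurushoPentagon

/-! ## Load-bearing analysis: every hypothesis is used by any proof

The crux has two hypotheses — `Z` pinned on admissible indices, `s` admissible (= all entries `≥ 1`
AND head `≥ 2`) — and one hidden convention (Hoffman's placement `(…, s_i − j, j + 1, …)` of the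
decreasing-sum convention). Each is load-bearing, uniformly (whole families of witnesses, not one): -/

/-! ### (a) Drop the pinning of `Z` -/

/-- **Any proof must use the pinning**: with `Z(3) := [ζ-rep(3)]`, `Z := 0` elsewhere, the element at
`s = (2)` is `[ζ-rep(3)] ∉ relations`. [folklore] -/
theorem false_without_pinning :
    ¬ ∀ (Z : List ℕ → FormalRep) (s : List ℕ), MZV.IsAdmissible s → hoffmanElement Z s ∈ relations := by
  intro h
  have h3 : MZV.IsAdmissible [3] := by decide
  have := h (fun u => if u = [3] then of (zRep [3] h3) else 0) [2] (by decide)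
  rw [hoffmanElement_two] at this
  simp only [if_true, List.cons.injEq, if_neg (show ¬ (2 = 3 ∧ [1] = ([] : List ℕ)) by simp)] at this
  simp at this
  exact of_zRep_not_mem_relations h3 this

/-! ### (b) Drop admissibility of `s` — with the CANONICAL classes (`ρ = 0` off admissible indices,
i.e. "divergent ζ's regularised to 0"), so that no junk-`Z` is involved: the failure is arithmetic. -/

/-- A sum of zeros over a list. [folklore] -/
theorem list_sum_map_eq_zero {α M : Type*} [AddCommMonoid M] (l : List α) (f : α → M)
    (h : ∀ x ∈ l, f x = 0) : (l.map f).sum = 0 := by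
  rw [List.map_congr_left h]; simp

/-- **Head `1` (the `ζ(1)` corner)**: for `s = (1, t)` every raised or split index except `(2, t)` has
head `1`, so `H_ρ(1, t) = ρ(2, t)`. -/
theorem hoffmanElement_zetaRep_one_cons (t : List ℕ) :
    hoffmanElement zetaRep (1 :: t) = zetaRep (2 :: t) := by
  have hna : ∀ u : List ℕ, ¬ MZV.IsAdmissible (1 :: u) := fun u h => by
    have := (MZV.isAdmissible_cons_iff.mp h).1; omega
  rw [hoffmanElement_eq]
  have h2 : ∀ i ∈ List.range (1 :: t).length,
      ((List.range ((1 :: t).getD i 0 - 1)).map (fun j => zetaRep (split (1 :: t) i j))).sum = 0 := by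
    intro i _
    cases i with
    | zero => simp
    | succ i =>
      refine list_sum_map_eq_zero _ _ fun j _ => ?_
      rw [split_cons_succ, zetaRep_of_not_isAdmissible (hna _)]
  rw [list_sum_map_eq_zero _ _ h2, sub_zero, List.length_cons, List.range_succ_eq_map, List.map_cons,
    List.sum_cons, raise_cons_zero, List.map_map]
  rw [list_sum_map_eq_zero _ _ fun i _ => ?_, add_zero]
  rw [Function.comp_apply, raise_cons_succ, zetaRep_of_not_isAdmissible (hna _)]

/-- **Every head-`1` instance is false** (uniformly in the tail): Hoffman's formula at `s = (1, t)` would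
put `[ζ-rep(2, t)]` (value `ζ(2, t) > 0`) in `relations`. So admissibility of `s` is load-bearing
through its HEAD condition, at every index — the `ζ(1)`-divergence is exactly where the printed
relation stops (its correct extension regularises, IKZ 2006 Thm 2 (v)). [folklore] -/
theorem false_at_head_one (t : List ℕ) (ht : ∀ x ∈ t, 1 ≤ x) :
    hoffmanElement zetaRep (1 :: t) ∉ relations := by
  rw [hoffmanElement_zetaRep_one_cons]
  exact zetaRep_not_mem_relations (MZV.isAdmissible_cons_iff.mpr ⟨le_rfl, ht⟩)

/-- In particular `s = (1)`: "`ζ(2) ∈ relations`". -/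
theorem false_without_admissibility : ¬ ∀ s : List ℕ, hoffmanElement zetaRep s ∈ relations :=
  fun h => false_at_head_one [] (by simp) (h _)

/-- **Head `0` is harmless** (every index produced has head `≤ 1`): `H_ρ(0, t) = 0`. So with the
canonical classes the head condition fails EXACTLY at head `1`. -/
theorem hoffmanElement_zetaRep_zero_cons (t : List ℕ) : hoffmanElement zetaRep (0 :: t) = 0 := by
  have hna0 : ∀ u : List ℕ, ¬ MZV.IsAdmissible (0 :: u) := fun u h => by
    have := (MZV.isAdmissible_cons_iff.mp h).1; omega
  have hna1 : ∀ u : List ℕ, ¬ MZV.IsAdmissible (1 :: u) := fun u h => by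
    have := (MZV.isAdmissible_cons_iff.mp h).1; omega
  rw [hoffmanElement_eq]
  have h2 : ∀ i ∈ List.range (0 :: t).length,
      ((List.range ((0 :: t).getD i 0 - 1)).map (fun j => zetaRep (split (0 :: t) i j))).sum = 0 := by
    intro i _
    cases i with
    | zero => simp
    | succ i =>
      refine list_sum_map_eq_zero _ _ fun j _ => ?_
      rw [split_cons_succ, zetaRep_of_not_isAdmissible (hna0 _)]
  rw [list_sum_map_eq_zero _ _ h2, sub_zero]
  refine list_sum_map_eq_zero _ _ fun i _ => ?_
  cases i with
  | zero => rw [raise_cons_zero, zetaRep_of_not_isAdmissible (hna1 _)]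
  | succ i => rw [raise_cons_succ, zetaRep_of_not_isAdmissible (hna0 _)]

/-- **Interior positivity is load-bearing too**: at `s = (a, 0, t)` (`a ≥ 2`, `t` positive) the only
surviving term is the raised index `(a, 1, t)`: `H_ρ(a, 0, t) = ρ(a, 1, t)`, of value `ζ(a,1,t) > 0`. -/
theorem hoffmanElement_zetaRep_cons_zero_cons (a : ℕ) (t : List ℕ) :
    hoffmanElement zetaRep (a :: 0 :: t) = zetaRep (a :: 1 :: t) := by
  have hna : ∀ (b : ℕ) (u : List ℕ), ¬ MZV.IsAdmissible (b :: 0 :: u) := fun b u h => by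
    have := (MZV.isAdmissible_cons_iff.mp h).2 0 (by simp); omega
  have hna' : ∀ (b c : ℕ) (u : List ℕ), ¬ MZV.IsAdmissible (b :: c :: 0 :: u) := fun b c u h => by
    have := (MZV.isAdmissible_cons_iff.mp h).2 0 (by simp); omega
  rw [hoffmanElement_eq]
  have h2 : ∀ i ∈ List.range (a :: 0 :: t).length,
      ((List.range ((a :: 0 :: t).getD i 0 - 1)).map (fun j => zetaRep (split (a :: 0 :: t) i j))).sum = 0 := by
    intro i _
    rcases i with _ | _ | i
    · refine list_sum_map_eq_zero _ _ fun j _ => ?_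
      rw [split_cons_zero, zetaRep_of_not_isAdmissible (hna' _ _ _)]
    · simp
    · refine list_sum_map_eq_zero _ _ fun j _ => ?_
      rw [split_cons_succ, split_cons_succ, zetaRep_of_not_isAdmissible (hna _ _)]
  rw [list_sum_map_eq_zero _ _ h2, sub_zero]
  rw [List.length_cons, List.length_cons, List.range_succ_eq_map, List.map_cons, List.sum_cons,
    raise_cons_zero, zetaRep_of_not_isAdmissible (hna _ _), zero_add, List.range_succ_eq_map,
    List.map_cons, List.map_cons, List.sum_cons, List.map_map, List.map_map]
  rw [list_sum_map_eq_zero _ _ fun i _ => ?_, add_zero]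
  · simp [raise]
  · simp only [Function.comp_apply, raise_cons_succ]
    exact zetaRep_of_not_isAdmissible (hna _ _)

/-- **Every `(a, 0, t)` instance is false** (`a ≥ 2`, `t` positive). [folklore] -/
theorem false_at_interior_zero {a : ℕ} (ha : 2 ≤ a) (t : List ℕ) (ht : ∀ x ∈ t, 1 ≤ x) :
    hoffmanElement zetaRep (a :: 0 :: t) ∉ relations := by
  rw [hoffmanElement_zetaRep_cons_zero_cons]
  refine zetaRep_not_mem_relations (MZV.isAdmissible_cons_iff.mpr ⟨ha, ?_⟩)
  intro x hx
  rcases List.mem_cons.mp hx with rfl | hx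
  · exact le_rfl
  · exact ht x hx

/-! ### (c) The placement convention is load-bearing: the MIRROR family `(…, j + 1, s_i − j, …)`
(Hoffman's relation in the INCREASING-sum convention `n₁ < ⋯ < n_k`, last entry `≥ 2`) is not a
relation family for the tree's decreasing convention. -/

/-- At `s = (2)` the MIRROR element (split block `(j + 1, s_i − j)`) is `Z(3) − Z(1,2)`. [folklore] -/
theorem hoffmanElementMirror_two (Z : List ℕ → FormalRep) :
    ((List.range [2].length).map (fun i => Z ([2].take i ++ [[2].getD i 0 + 1] ++ [2].drop (i + 1)))).sum -
      ((List.range [2].length).map (fun i => ((List.range ([2].getD i 0 - 1)).map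
        (fun j => Z ([2].take i ++ [j + 1, [2].getD i 0 - j] ++ [2].drop (i + 1)))).sum)).sum =
      Z [3] - Z [1, 2] := by
  simp

/-- **The mirrored statement is false** already at `s = (2)` for the canonical classes
(`ρ(1,2) = 0`, so it reads `[ζ-rep(3)] ∈ relations`), and for EVERY pinned `Z` with `Z(1,2)` of value
`≠ ζ(3)`. Any refuter reading `IsAdmissible` as "last entry `≥ 2`" would wrongly refute the crux; the
tree's convention (head `≥ 2`, `MultipleZeta.lean`) makes the crux's placement the right one. -/
theorem mirror_false_at_two :
    ((List.range [2].length).map (fun i => zetaRep ([2].take i ++ [[2].getD i 0 + 1] ++ [2].drop (i + 1)))).sum -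
      ((List.range [2].length).map (fun i => ((List.range ([2].getD i 0 - 1)).map
        (fun j => zetaRep ([2].take i ++ [j + 1, [2].getD i 0 - j] ++ [2].drop (i + 1)))).sum)).sum ∉
      relations := by
  rw [hoffmanElementMirror_two, zetaRep_of_not_isAdmissible (u := [1, 2]) (by decide), sub_zero]
  exact zetaRep_not_mem_relations (by decide)


/-! ## Natural strengthenings, refuted

* **termwise** (one raised term against its own splits, position by position) — false at `s = (2,1)`,
  BOTH positions: position `1` reads `[ζ-rep(2,2)] ∈ relations`, position `0` reads
  `[ζ-rep(3,1)] − [ζ-rep(2,1,1)] ∈ relations`, of value `−ζ(2,2)`;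
* **on the nose** (`H_Z(s) = 0` in the free group) — false at `s = (2)` (the two representations of
  `ζ(3)` and `ζ(2,1)` are distinct generators), so the relation subgroup is genuinely used;
* **without additivity / without a non-additive move** — §3;
* **beyond admissibility by zero-regularisation** — §2(b). -/

/-- **Termwise Hoffman is false** — the strengthening "each raised index against its own splits,
position by position" fails (witness `s = (2,1)`, position `1`: `[ζ-rep(2,2)] ∉ relations`). [folklore] -/
theorem not_hoffmanTermwise :
    ¬ ∀ Z : List ℕ → FormalRep, Pinned Z → ∀ s : List ℕ, MZV.IsAdmissible s → ∀ i < s.length,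
      Z (raise s i) - ((List.range (s.getD i 0 - 1)).map fun j => Z (split s i j)).sum ∈ relations := by
  intro h
  have := h zetaRep pinned_zetaRep [2, 1] (by decide) 1 (by decide)
  have e : raise [2, 1] 1 = [2, 2] := by decide
  rw [e] at this
  simp only [List.getD_cons_succ, List.getD_cons_zero, le_refl, tsub_eq_zero_of_le, List.range_zero,
    List.map_nil, List.sum_nil, sub_zero] at this
  exact zetaRep_not_mem_relations (by decide) this

/-- Position `0` of `s = (2,1)` fails as well: `[ζ-rep(3,1)] − [ζ-rep(2,1,1)]` has value
`ζ(3,1) − ζ(2,1,1) = −ζ(2,2) ≠ 0` (`multipleZeta_two_one_one_eq_add`). -/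
theorem termwise_false_at_two_one_zero : zetaRep [3, 1] - zetaRep [2, 1, 1] ∉ relations := by
  intro h
  have h0 : eval (zetaRep [3, 1] - zetaRep [2, 1, 1]) = 0 := relations_le_ker_eval_holds h
  rw [map_sub, eval_zetaRep (by decide), eval_zetaRep (by decide), multipleZeta_two_one_one_eq_add] at h0
  have := multipleZeta_pos_of_isAdmissible_holds (s := [2, 2]) (by decide)
  linarith

/-- The two representations of Euler's identity are different generators of the free group. -/
theorem zRep_three_ne_zRep_two_one :
    (⟨3, zRep [3] (by decide)⟩ : Σ n, IntegralRep n) ≠ ⟨3, zRep [2, 1] (by decide)⟩ := by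
  intro h
  have hint : (zRep [3] (by decide)).integrand = (zRep [2, 1] (by decide)).integrand := by
    have := congrArg (fun x : (Σ n, IntegralRep n) => (⟨x.1, x.2.integrand⟩ : Σ n, (Fin n → ℝ) → ℝ)) h
    simp only [Sigma.mk.injEq, heq_eq_eq, true_and] at this
    exact this
  -- evaluate both integrands at `t = (1/2, 1/4, 1/2)`: `16` versus `16/3`
  have key := congrFun hint (![1/2, 1/4, 1/2] : Fin 3 → ℝ)
  change (∏ i : Fin 3, mzvForm ((MZV.binaryWord [3]).getD i false) ((![1/2, 1/4, 1/2] : Fin 3 → ℝ) i)) =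
    ∏ i : Fin 3, mzvForm ((MZV.binaryWord [2, 1]).getD i false) ((![1/2, 1/4, 1/2] : Fin 3 → ℝ) i) at key
  simp [Fin.prod_univ_three, mzvForm, MZV.binaryWord] at key
  norm_num at key

/-- **"On the nose" is false**: `H_ρ(2) = [ζ-rep 3] − [ζ-rep(2,1)] ≠ 0` in `FormalRep`; Euler's
identity is a genuine relation, not a syntactic one. [folklore] -/
theorem hoffmanElement_two_ne_zero : hoffmanElement zetaRep [2] ≠ 0 := by
  rw [hoffmanElement_two, zetaRep_of_isAdmissible (by decide), zetaRep_of_isAdmissible (by decide),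
    sub_ne_zero]
  exact fun h => zRep_three_ne_zRep_two_one (FreeAbelianGroup.of_injective h)


end Summit.KontsevichZagierPeriods.HoffmanRelationInKZ.Negative
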